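import Mathlib

/-!
# No exact twisted cycle ⇒ uniform word contraction (stub `stub_uwcOfNoExact`)

The stub `stub_uwcOfNoExact` of the crux `MobiusLadder.QuadraticDigitPhases`
(stmt-QuantumAdvantage-1391), line `Sketch`, with its lemmas.  Mathlib only.

Pair-carry chain of `T ↦ (pT, qT)` on the states `[0,p) × [0,q)`: letters `M_{ab}` (two half-weight
digit moves, twisted by the output bits when `ab ≠ ff`), `U = M_{ff}`, `π` stationary on the set `R`
of states reachable from `(0,0)`, `Π = 𝟙 ⊗ π`.  From `U^k(x,·) → π` in `ℓ¹` at `x ∈ R` (STAT) and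
the strict bound `< 1` on the `R`-rows of every generalized word in `M_{ab}, Π` with `≥ m` twisted
letters (NOEXACT) we get a UNIFORM `K < 1` for the plain words with `≥ m` twisted letters (UWC), by
compactness: a plain word is `ff^{k₁} ℓ₁ ⋯ ff^{k_m} ℓ_m · rest` (`exists_blocks`), the tail only
contracts (`l1_mul_prod_le`), and on the compact padding space `(OnePoint ℕ)^m` (`U^∞ := Π`) the
`R`-rows of the block product are continuous (`continuous_pad`, after freezing the rows of `U^k` off
`R`, harmless by `R`-closedness: `reach_step`, `vecMul_prod_congr`), so their absolute sums attain a
maximum, which is `< 1` by NOEXACT at a generalized word with `m` twisted letters (`core`).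
-/

set_option linter.dupNamespace false -- D-0017: single-problem summit ⇒ `QuantumAdvantage.QuantumAdvantage` by design

namespace Summit.QuantumAdvantage.QuantumAdvantage.Theorems.MobiusLadderQuadraticDigitPhasesStubUwcOfNoExact

open Finset Filter Topology
open scoped Matrix OnePoint

-- adapted from …Theorems.MobiusLadderQuadraticDigitPhasesStubWordDecayOfUWC.l1_vecMul_le (case `K = 1`)
/-- `ℓ¹`-contraction of row vectors: absolute row sums `≤ 1` give `‖v A‖₁ ≤ ‖v‖₁`. -/
theorem l1_vecMul_le {ι : Type*} [Fintype ι] (A : Matrix ι ι ℝ) (hA : ∀ s, ∑ y, |A s y| ≤ 1)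
    (v : ι → ℝ) : ∑ y, |(v ᵥ* A) y| ≤ ∑ s, |v s| :=
  calc ∑ y, |(v ᵥ* A) y| = ∑ y, |∑ s, v s * A s y| := rfl
    _ ≤ ∑ y, ∑ s, |v s| * |A s y| := Finset.sum_le_sum fun y _ =>
        (Finset.abs_sum_le_sum_abs _ _).trans_eq (Finset.sum_congr rfl fun s _ => abs_mul _ _)
    _ = ∑ s, |v s| * ∑ y, |A s y| := by rw [Finset.sum_comm]; simp_rw [Finset.mul_sum]
    _ ≤ ∑ s, |v s| := Finset.sum_le_sum fun s _ =>
        (mul_le_mul_of_nonneg_left (hA s) (abs_nonneg _)).trans_eq (mul_one _)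

/-- Words `W` in `ℓ¹`-contracting letters contract row vectors: `‖v W‖₁ ≤ ‖v‖₁`. -/
theorem l1_mul_prod_le {ι L : Type*} [Fintype ι] [DecidableEq ι] (M : L → Matrix ι ι ℝ)
    (hrow : ∀ a x, ∑ y, |M a x y| ≤ 1) :
    ∀ (w : List L) (v : ι → ℝ), ∑ y, |(v ᵥ* (w.map M).prod) y| ≤ ∑ y, |v y| := by
  intro w
  induction w with
  | nil => intro v; rw [List.map_nil, List.prod_nil, Matrix.vecMul_one]
  | cons a w ih =>
    intro v
    rw [List.map_cons, List.prod_cons, ← Matrix.vecMul_vecMul]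
    exact (ih _).trans (l1_vecMul_le (M a) (hrow a) v)

/-- If the moves of `A` from `R`-states stay in `R`, then `v A` is carried by `R` when `v` is. -/
theorem supp_vecMul {ι : Type*} [Fintype ι] (R : ι → Prop) (A : Matrix ι ι ℝ)
    (hA : ∀ x y, R x → A x y ≠ 0 → R y) (v : ι → ℝ) (hv : ∀ x, v x ≠ 0 → R x) (y : ι)
    (hy : (v ᵥ* A) y ≠ 0) : R y := by
  obtain ⟨x, -, hx⟩ := Finset.exists_ne_zero_of_sum_ne_zero (hy : ∑ x, v x * A x y ≠ 0)
  exact hA x y (hv x (left_ne_zero_of_mul hx)) (right_ne_zero_of_mul hx)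

/-- Powers of a matrix whose moves from `R`-states stay in `R` have the same property. -/
theorem rpres_pow {ι : Type*} [Fintype ι] [DecidableEq ι] (R : ι → Prop) (A : Matrix ι ι ℝ)
    (hA : ∀ x y, R x → A x y ≠ 0 → R y) : ∀ (n : ℕ) (x y : ι), R x → (A ^ n) x y ≠ 0 → R y
  | 0, x, y, hx, h => by
    by_contra hy
    exact h (by rw [pow_zero]; exact Matrix.one_apply_ne fun hxy => hy (hxy ▸ hx))
  | n + 1, x, y, hx, h => by
    rw [pow_succ] at h
    exact supp_vecMul R A hA ((A ^ n) x) (fun z hz => rpres_pow R A hA n x z hx hz) y h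

/-- Two letter systems agreeing on the rows at `R`-states, the first mapping `R`-carried row vectors to
`R`-carried ones, have words acting identically on `R`-carried row vectors. -/
theorem vecMul_prod_congr {ι α : Type*} [Fintype ι] [DecidableEq ι] (R : ι → Prop)
    (A B : α → Matrix ι ι ℝ) (hAB : ∀ a x, R x → A a x = B a x)
    (hA : ∀ a x y, R x → A a x y ≠ 0 → R y) :
    ∀ (L : List α) (v : ι → ℝ), (∀ x, v x ≠ 0 → R x) →
      v ᵥ* (L.map A).prod = v ᵥ* (L.map B).prod := by
  intro L
  induction L with
  | nil => intro v _; rfl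
  | cons a L ih =>
    intro v hv
    have h1 : v ᵥ* A a = v ᵥ* B a := funext fun y => Finset.sum_congr rfl fun x _ => by
      by_cases hx : v x = 0
      · simp only [hx, zero_mul]
      · simp only [hAB a x (hv x hx)]
    rw [List.map_cons, List.map_cons, List.prod_cons, List.prod_cons, ← Matrix.vecMul_vecMul,
      ← Matrix.vecMul_vecMul, ← h1]
    exact ih _ (supp_vecMul R (A a) (hA a) v hv)

-- adapted from …Theorems.MobiusLadderQuadraticDigitPhasesStubWordDecayOfUWC: `sum_abs_sum_pair_le`, `abs_twist`,
-- `carry_step`, `sum_abs_letter_le`, `reach_step` (self-contained copies, kept private: that module has no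
-- olean on the farm yet, so it cannot be imported)
/-- Two half-weight digit moves, each hitting at most one state, give absolute row sums `≤ 1`. -/
private theorem sum_abs_sum_pair_le {ι : Type*} [Fintype ι] (F : ℕ → ι → ℝ) (hF : ∀ t y, |F t y| ≤ 1 / 2)
    (huniq : ∀ t y y', F t y ≠ 0 → F t y' ≠ 0 → y = y') :
    ∑ y, |∑ t ∈ ({0, 1} : Finset ℕ), F t y| ≤ 1 := by
  have ht : ∀ t, ∑ y, |F t y| ≤ 1 / 2 := by
    intro t
    by_cases h : ∃ y₀, F t y₀ ≠ 0
    · obtain ⟨y₀, hy₀⟩ := h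
      rw [Finset.sum_eq_single y₀ (fun y _ hy => abs_eq_zero.2 (of_not_not fun hy' =>
        hy (huniq t y y₀ hy' hy₀))) (fun h => absurd (Finset.mem_univ _) h)]
      exact hF t y₀
    · push Not at h
      rw [Finset.sum_eq_zero fun y _ => by rw [h y, abs_zero]]
      norm_num
  calc ∑ y, |∑ t ∈ ({0, 1} : Finset ℕ), F t y|
      ≤ ∑ y, ∑ t ∈ ({0, 1} : Finset ℕ), |F t y| :=
        Finset.sum_le_sum fun y _ => Finset.abs_sum_le_sum_abs _ _
    _ = ∑ t ∈ ({0, 1} : Finset ℕ), ∑ y, |F t y| := Finset.sum_comm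
    _ ≤ ∑ t ∈ ({0, 1} : Finset ℕ), (1 / 2 : ℝ) := Finset.sum_le_sum fun t _ => ht t
    _ = 1 := by rw [Finset.sum_pair zero_ne_one]; norm_num

/-- A twist factor `(-1)^n` (or `1`, untwisted) has absolute value `1`. -/
private theorem abs_twist (b : Bool) (n : ℕ) : |(if b then (-1 : ℝ) ^ n else 1)| = 1 := by
  cases b <;> simp

/-- One digit move keeps carries of the shape `⌊p T/2^c⌋`, `T < 2^c`:
`⌊p (2^c t + T) / 2^{c+1}⌋ = ⌊(p t + ⌊p T/2^c⌋)/2⌋`. -/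
private theorem carry_step (p c t T : ℕ) :
    p * (2 ^ c * t + T) / 2 ^ (c + 1) = (p * t + p * T / 2 ^ c) / 2 := by
  rw [pow_succ, ← Nat.div_div_eq_div_mul, show p * (2 ^ c * t + T) = p * T + p * t * 2 ^ c by ring,
    Nat.add_mul_div_right _ _ (Nat.two_pow_pos c), add_comm]

/-- Each pair-carry letter matrix is an `ℓ¹`-contraction on row vectors: `Σ_y |M_{ab} x y| ≤ 1`. -/
private theorem sum_abs_letter_le {p q : ℕ} (M : Bool × Bool → Matrix (Fin p × Fin q) (Fin p × Fin q) ℝ)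
    (hM : M = fun ab : Bool × Bool => (Matrix.of fun (x y : Fin p × Fin q) =>
      ∑ t ∈ ({0, 1} : Finset ℕ),
        if (y.1 : ℕ) = (p * t + x.1) / 2 ∧ (y.2 : ℕ) = (q * t + x.2) / 2 then
          (1 / 2 : ℝ) * (if ab.1 then (-1 : ℝ) ^ ((p * t + x.1) % 2) else 1) *
            (if ab.2 then (-1 : ℝ) ^ ((q * t + x.2) % 2) else 1)
        else 0))
    (ab : Bool × Bool) (x : Fin p × Fin q) : ∑ y, |M ab x y| ≤ 1 := by
  subst hM
  simp only [Matrix.of_apply]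
  refine sum_abs_sum_pair_le _ (fun t y => ?_) (fun t y y' h h' => ?_)
  · by_cases hc : (y.1 : ℕ) = (p * t + x.1) / 2 ∧ (y.2 : ℕ) = (q * t + x.2) / 2
    · rw [if_pos hc, abs_mul, abs_mul, abs_twist, abs_twist, mul_one, mul_one,
        abs_of_pos (by norm_num : (0 : ℝ) < 1 / 2)]
    · rw [if_neg hc, abs_zero]
      norm_num
  · have hc : (y.1 : ℕ) = (p * t + x.1) / 2 ∧ (y.2 : ℕ) = (q * t + x.2) / 2 :=
      of_not_not fun hc => h (if_neg hc)
    have hc' : (y'.1 : ℕ) = (p * t + x.1) / 2 ∧ (y'.2 : ℕ) = (q * t + x.2) / 2 :=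
      of_not_not fun hc' => h' (if_neg hc')
    exact Prod.ext (Fin.ext (hc.1.trans hc'.1.symm)) (Fin.ext (hc.2.trans hc'.2.symm))

/-- The reachable states `(⌊pT/2^c⌋, ⌊qT/2^c⌋)`, `T < 2^c`, are closed under the letters: a nonzero
entry `M_{ab} s y` forces `y = (⌊pT'/2^{c+1}⌋, ⌊qT'/2^{c+1}⌋)` with `T' = 2^c t + T`. -/
private theorem reach_step {p q : ℕ} (M : Bool × Bool → Matrix (Fin p × Fin q) (Fin p × Fin q) ℝ)
    (hM : M = fun ab : Bool × Bool => (Matrix.of fun (x y : Fin p × Fin q) =>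
      ∑ t ∈ ({0, 1} : Finset ℕ),
        if (y.1 : ℕ) = (p * t + x.1) / 2 ∧ (y.2 : ℕ) = (q * t + x.2) / 2 then
          (1 / 2 : ℝ) * (if ab.1 then (-1 : ℝ) ^ ((p * t + x.1) % 2) else 1) *
            (if ab.2 then (-1 : ℝ) ^ ((q * t + x.2) % 2) else 1)
        else 0))
    (ab : Bool × Bool) (s y : Fin p × Fin q)
    (hs : ∃ c T : ℕ, T < 2 ^ c ∧ (s.1 : ℕ) = p * T / 2 ^ c ∧ (s.2 : ℕ) = q * T / 2 ^ c)
    (h : M ab s y ≠ 0) :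
    ∃ c T : ℕ, T < 2 ^ c ∧ (y.1 : ℕ) = p * T / 2 ^ c ∧ (y.2 : ℕ) = q * T / 2 ^ c := by
  subst hM
  simp only [Matrix.of_apply] at h
  obtain ⟨t, ht, hty⟩ := Finset.exists_ne_zero_of_sum_ne_zero h
  have hc : (y.1 : ℕ) = (p * t + s.1) / 2 ∧ (y.2 : ℕ) = (q * t + s.2) / 2 :=
    of_not_not fun hc => hty (if_neg hc)
  obtain ⟨c, T, hT, hs1, hs2⟩ := hs
  have ht1 : t ≤ 1 := by simp only [Finset.mem_insert, Finset.mem_singleton] at ht; omega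
  have h2 : 2 ^ c * t ≤ 2 ^ c := mul_le_of_le_one_right (Nat.zero_le _) ht1
  exact ⟨c + 1, 2 ^ c * t + T, by rw [pow_succ]; omega, by rw [hc.1, hs1, carry_step],
    by rw [hc.2, hs2, carry_step]⟩

/-- A word with a letter `≠ e` reads `e^n a w'` with `a ≠ e`. -/
theorem exists_prefix {L : Type*} [DecidableEq L] (e : L) :
    ∀ w : List L, 0 < (w.filter fun a => a ≠ e).length →
      ∃ (n : ℕ) (a : L) (w' : List L), a ≠ e ∧ w = List.replicate n e ++ a :: w' := by
  intro w
  induction w with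
  | nil => intro h; simp at h
  | cons b w ih =>
    intro h
    by_cases hb : b = e
    · subst hb
      obtain ⟨n, a, w', ha, rfl⟩ := ih (by simpa using h)
      exact ⟨n + 1, a, w', ha, rfl⟩
    · exact ⟨0, b, w, hb, rfl⟩

/-- A word with at least `m` letters `≠ e` starts with `m` blocks `e^{k_i} ℓ_i`, `ℓ_i ≠ e`. -/
theorem exists_blocks {L : Type*} [DecidableEq L] (e : L) :
    ∀ (m : ℕ) (w : List L), m ≤ (w.filter fun a => a ≠ e).length →
      ∃ (k : Fin m → ℕ) (ℓ : Fin m → L) (rest : List L), (∀ i, ℓ i ≠ e) ∧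
        w = (List.ofFn fun i => List.replicate (k i) e ++ [ℓ i]).flatten ++ rest := by
  intro m
  induction m with
  | zero => intro w _; exact ⟨Fin.elim0, Fin.elim0, w, fun i => i.elim0, by simp⟩
  | succ m ih =>
    intro w hw
    obtain ⟨n, a, w', ha, rfl⟩ := exists_prefix e w (by omega)
    have hw' : m ≤ (w'.filter fun a => a ≠ e).length := by
      simpa [List.filter_append, List.filter_replicate, ha] using hw
    obtain ⟨k, ℓ, rest, hℓ, rfl⟩ := ih w' hw'
    refine ⟨Fin.cons n k, Fin.cons a ℓ, rest, fun i => ?_, by simp [List.ofFn_succ]⟩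
    cases i using Fin.cases with
    | zero => simpa using ha
    | succ j => simpa using hℓ j

/-- The paddings `U^k`, extended by `Π` at `k = ∞` and with the rows off `R` frozen to `π`, depend
continuously on `k ∈ OnePoint ℕ`: this is the convergence `U^k(x, ·) → π` at the `R`-states. -/
theorem continuous_pad {ι : Type*} [Fintype ι] [DecidableEq ι] (R : ι → Prop) (U : Matrix ι ι ℝ)
    (π : ι → ℝ)
    (hG : ∀ ε : ℝ, 0 < ε → ∃ G : ℕ, ∀ k : ℕ, G ≤ k → ∀ x, R x → ∑ y, |(U ^ k) x y - π y| ≤ ε)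
    (F : OnePoint ℕ → Matrix ι ι ℝ) (hFi : F ∞ = Matrix.of fun _ y => π y)
    (hF1 : ∀ (n : ℕ) (x y : ι), R x → F n x y = (U ^ n) x y)
    (hF2 : ∀ (n : ℕ) (x y : ι), ¬ R x → F n x y = π y) : Continuous F := by
  rw [OnePoint.continuous_iff_from_nat, hFi]
  refine tendsto_pi_nhds.2 fun x => tendsto_pi_nhds.2 fun y => ?_
  by_cases hx : R x
  · have e : ∀ n : ℕ, F n x y = (U ^ n) x y := fun n => hF1 n x y hx
    simp only [e, Matrix.of_apply]
    refine Metric.tendsto_atTop.2 fun ε hε => ?_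
    obtain ⟨G, hG'⟩ := hG (ε / 2) (half_pos hε)
    refine ⟨G, fun n hn => ?_⟩
    rw [Real.dist_eq]
    exact ((Finset.single_le_sum (f := fun y' => |(U ^ n) x y' - π y'|) (fun _ _ => abs_nonneg _)
      (Finset.mem_univ y)).trans (hG' n hn x hx)).trans_lt (half_lt_self hε)
  · have e : ∀ n : ℕ, F n x y = π y := fun n => hF2 n x y hx
    simp only [e, Matrix.of_apply]
    exact tendsto_const_nhds

/-- CORE (compactness): under STAT-convergence `hG`, `R`-closedness `hstep`, `π = 0` off `R` and
NOEXACT `hm`, the block words `ff^{k₁} ℓ₁ ⋯ ff^{k_m} ℓ_m` (`ℓ` fixed, twisted) have absolute row sums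
at the `R`-state `s` bounded by some `K < 1` uniformly in the paddings `k`. -/
theorem core {ι : Type*} [Fintype ι] [DecidableEq ι] (R : ι → Prop)
    (M : Bool × Bool → Matrix ι ι ℝ) (U : Matrix ι ι ℝ) (π : ι → ℝ) (m : ℕ)
    (hMU : M (false, false) = U) (hstep : ∀ ab x y, R x → M ab x y ≠ 0 → R y)
    (hπ : ∀ y, ¬ R y → π y = 0)
    (hG : ∀ ε : ℝ, 0 < ε → ∃ G : ℕ, ∀ k : ℕ, G ≤ k → ∀ x, R x → ∑ y, |(U ^ k) x y - π y| ≤ ε)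
    (hm : ∀ w : List (Option (Bool × Bool)),
      m ≤ (w.filter fun l => l ≠ none ∧ l ≠ some (false, false)).length → ∀ s, R s →
        ∑ y, |(w.map fun l => l.elim (Matrix.of fun _ y => π y) M).prod s y| < 1)
    (s : ι) (hs : R s) (ℓ : Fin m → Bool × Bool) (hℓ : ∀ i, ℓ i ≠ (false, false)) :
    ∃ K : ℝ, K < 1 ∧ ∀ k : Fin m → ℕ,
      ∑ y, |((List.ofFn fun i => List.replicate (k i) (false, false) ++ [ℓ i]).flatten.map M).prod s y|
        ≤ K := by
  classical
  -- paddings: true (`Pd`: `U^k`, `Π` at `∞`) and with the rows off `R` frozen to `π` (`Pf`)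
  obtain ⟨Pd, hPdi, hPdn⟩ : ∃ F : OnePoint ℕ → Matrix ι ι ℝ, F ∞ = Matrix.of (fun _ y => π y) ∧
      ∀ n : ℕ, F n = U ^ n := ⟨fun o => o.elim (Matrix.of fun _ y => π y) fun n => U ^ n, rfl, fun _ => rfl⟩
  obtain ⟨Pf, hPfi, hPf1, hPf2⟩ : ∃ F : OnePoint ℕ → Matrix ι ι ℝ, F ∞ = Matrix.of (fun _ y => π y) ∧
      (∀ (n : ℕ) (x y : ι), R x → F n x y = (U ^ n) x y) ∧ ∀ (n : ℕ) (x y : ι), ¬ R x → F n x y = π y :=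
    ⟨fun o => o.elim (Matrix.of fun _ y => π y) fun n => Matrix.of fun x y => if R x then (U ^ n) x y else π y,
      rfl, fun n x y hx => by simp [hx], fun n x y hx => by simp [hx]⟩
  have hUp : ∀ x y, R x → U x y ≠ 0 → R y := fun x y hx h => hstep (false, false) x y hx (by rwa [hMU])
  have hpres : ∀ (o : OnePoint ℕ) (x y : ι), R x → Pd o x y ≠ 0 → R y := by
    intro o x y hx h
    induction o with
    | infty => rw [hPdi, Matrix.of_apply] at h; exact of_not_not fun hy => h (hπ y hy)
    | coe n => exact rpres_pow R U hUp n x y hx (by rwa [hPdn] at h)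
  have hr : ∀ (o : OnePoint ℕ) (x : ι), R x → Pd o x = Pf o x := by
    intro o x hx
    induction o with
    | infty => rw [hPdi, hPfi]
    | coe n => exact funext fun y => by rw [hPdn, hPf1 n x y hx]
  -- the frozen block products have the true rows at `R`-states ...
  have hid : ∀ k : Fin m → OnePoint ℕ, (List.ofFn fun i => Pd (k i) * M (ℓ i)).prod s =
      (List.ofFn fun i => Pf (k i) * M (ℓ i)).prod s := by
    intro k
    have h := vecMul_prod_congr R (fun i => Pd (k i) * M (ℓ i)) (fun i => Pf (k i) * M (ℓ i))
      (fun i x hx => ?_) (fun i x y hx h => ?_) (List.finRange m) (Pi.single s 1) fun x hx => ?_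
    · simpa only [Matrix.single_one_vecMul, Matrix.row_apply', ← List.ofFn_eq_map] using h
    · show Pd (k i) x ᵥ* M (ℓ i) = Pf (k i) x ᵥ* M (ℓ i)
      rw [hr (k i) x hx]
    · exact supp_vecMul R (M (ℓ i)) (hstep (ℓ i)) (Pd (k i) x) (fun z hz => hpres (k i) x z hx hz) y h
    · exact of_not_not fun hxR => hx (Pi.single_eq_of_ne (fun hxs : x = s => hxR (hxs ▸ hs)) 1)
  -- ... which are `< 1` by NOEXACT: the true block product is a generalized word with `m` twisted letters
  have hgw : ∀ k : Fin m → OnePoint ℕ, ∑ y, |(List.ofFn fun i => Pf (k i) * M (ℓ i)).prod s y| < 1 := by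
    intro k
    have hblock : ∀ o : OnePoint ℕ, (((o.elim [none] fun n => List.replicate n (some (false, false))).map
        fun l : Option (Bool × Bool) => l.elim (Matrix.of fun _ y => π y) M).prod) = Pd o := by
      intro o
      induction o with
      | infty => simp [hPdi]
      | coe n => simp [hPdn, List.prod_replicate, hMU]
    have hpad : ∀ o : OnePoint ℕ, ((o.elim [none] fun n => List.replicate n (some (false, false))).filter
        fun l : Option (Bool × Bool) => l ≠ none ∧ l ≠ some (false, false)) = [] := by
      intro o
      induction o <;> simp
    have h1 : ∀ i, (List.filter (fun l : Option (Bool × Bool) => l ≠ none ∧ l ≠ some (false, false))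
        [some (ℓ i)]).length = 1 := fun i => by simp [hℓ i]
    have h := hm ((List.ofFn fun i => ((k i).elim [none] fun n => List.replicate n (some (false, false)))
      ++ [some (ℓ i)]).flatten) (by
        simp only [List.filter_flatten, List.length_flatten, List.map_ofFn, List.sum_ofFn,
          Function.comp_def, List.filter_append, List.length_append, hpad, h1, List.length_nil, zero_add,
          Finset.sum_const, Finset.card_univ, Fintype.card_fin, smul_eq_mul, mul_one, le_refl]) s hs
    rw [← hid]
    simpa only [List.map_flatten, List.prod_flatten, List.map_ofFn, Function.comp_def, List.map_append,
      List.prod_append, List.map_cons, List.map_nil, List.prod_cons, List.prod_nil, mul_one, hblock,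
      Option.elim_some] using h
  -- compactness: the frozen row sums are continuous on `(OnePoint ℕ)^m`, hence attain their maximum
  have hgc : Continuous fun k : Fin m → OnePoint ℕ =>
      ∑ y, |(List.ofFn fun i => Pf (k i) * M (ℓ i)).prod s y| := by
    refine continuous_finsetSum _ fun y _ => (Continuous.matrix_elem ?_ s y).abs
    simp only [List.ofFn_eq_map]
    exact continuous_list_prod (f := fun (i : Fin m) (k : Fin m → OnePoint ℕ) => Pf (k i) * M (ℓ i)) _
      fun i _ => ((continuous_pad R U π hG Pf hPfi hPf1 hPf2).comp (continuous_apply i)).mul continuous_const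
  obtain ⟨k₀, -, hk₀⟩ := isCompact_univ.exists_isMaxOn Set.univ_nonempty hgc.continuousOn
  rw [isMaxOn_univ_iff] at hk₀
  refine ⟨_, hgw k₀, fun k => ?_⟩
  have hpw : ((List.ofFn fun i => List.replicate (k i) (false, false) ++ [ℓ i]).flatten.map M).prod =
      (List.ofFn fun i => Pd (k i) * M (ℓ i)).prod := by
    simp only [List.map_flatten, List.prod_flatten, List.map_ofFn, Function.comp_def, List.map_append,
      List.prod_append, List.map_replicate, List.prod_replicate, List.map_cons, List.map_nil,
      List.prod_cons, List.prod_nil, mul_one, hMU, hPdn]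
  rw [hpw, hid]
  exact hk₀ fun i => (k i : OnePoint ℕ)

/-- NO EXACT TWISTED CYCLE ⇒ UNIFORM WORD CONTRACTION (stub `stub_uwcOfNoExact` of the crux, line
`Sketch`): from STAT (stationary `π`, `ℓ¹`-convergence of the reachable rows of `U^k`) and NOEXACT
(reachable rows of generalized words with `≥ m₀` twisted letters have absolute sums `< 1`), a UNIFORM
`K < 1` for the plain words with `≥ m₀` twisted letters: `core` for each of the finitely many
`(state, twisted letters)`, after splitting off the `ℓ¹`-contracting tail (`exists_blocks`). -/
theorem stub_uwcOfNoExact :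
    ∀ p q : ℕ, p.Prime → q.Prime → p ≠ q → 2 < p → 2 < q →
      (∃ π : Fin p × Fin q → ℝ,
        (∀ s : Fin p × Fin q, (∃ c T : ℕ, T < 2 ^ c ∧ (s.1 : ℕ) = p * T / 2 ^ c ∧ (s.2 : ℕ) = q * T / 2 ^ c) → 0 < π s) ∧
        (∀ s : Fin p × Fin q, ¬ (∃ c T : ℕ, T < 2 ^ c ∧ (s.1 : ℕ) = p * T / 2 ^ c ∧ (s.2 : ℕ) = q * T / 2 ^ c) → π s = 0) ∧
        (∑ s : Fin p × Fin q, π s = 1) ∧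
        (∀ y : Fin p × Fin q, ∑ x : Fin p × Fin q, π x * (Matrix.of fun (x y : Fin p × Fin q) =>
          ∑ t ∈ ({0, 1} : Finset ℕ),
            if (y.1 : ℕ) = (p * t + x.1) / 2 ∧ (y.2 : ℕ) = (q * t + x.2) / 2 then (1 / 2 : ℝ) else 0) x y = π y) ∧
        (∀ ε : ℝ, 0 < ε → ∃ G : ℕ, ∀ k : ℕ, G ≤ k → ∀ x : Fin p × Fin q, (∃ c T : ℕ, T < 2 ^ c ∧ (x.1 : ℕ) = p * T / 2 ^ c ∧ (x.2 : ℕ) = q * T / 2 ^ c) →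
          ∑ y : Fin p × Fin q, |((Matrix.of fun (x y : Fin p × Fin q) =>
          ∑ t ∈ ({0, 1} : Finset ℕ),
            if (y.1 : ℕ) = (p * t + x.1) / 2 ∧ (y.2 : ℕ) = (q * t + x.2) / 2 then (1 / 2 : ℝ) else 0) ^ k) x y - π y| ≤ ε)) →
      (∀ π : Fin p × Fin q → ℝ,
        (∀ s : Fin p × Fin q, (∃ c T : ℕ, T < 2 ^ c ∧ (s.1 : ℕ) = p * T / 2 ^ c ∧ (s.2 : ℕ) = q * T / 2 ^ c) → 0 < π s) →
        (∀ s : Fin p × Fin q, ¬ (∃ c T : ℕ, T < 2 ^ c ∧ (s.1 : ℕ) = p * T / 2 ^ c ∧ (s.2 : ℕ) = q * T / 2 ^ c) → π s = 0) →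
        (∑ s : Fin p × Fin q, π s = 1) →
        (∀ y : Fin p × Fin q, ∑ x : Fin p × Fin q, π x * (Matrix.of fun (x y : Fin p × Fin q) =>
          ∑ t ∈ ({0, 1} : Finset ℕ),
            if (y.1 : ℕ) = (p * t + x.1) / 2 ∧ (y.2 : ℕ) = (q * t + x.2) / 2 then (1 / 2 : ℝ) else 0) x y = π y) →
        ∃ m₀ : ℕ, ∀ word : List (Option (Bool × Bool)),
          m₀ ≤ (word.filter (fun l => l ≠ none ∧ l ≠ some (false, false))).length →
          ∀ s : Fin p × Fin q, (∃ c T : ℕ, T < 2 ^ c ∧ (s.1 : ℕ) = p * T / 2 ^ c ∧ (s.2 : ℕ) = q * T / 2 ^ c) →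
          ∑ y : Fin p × Fin q,
            |((word.map (fun l : Option (Bool × Bool) =>
              l.elim (Matrix.of fun (_ y : Fin p × Fin q) => π y) (fun ab : Bool × Bool =>
                (Matrix.of fun (x y : Fin p × Fin q) =>
              ∑ t ∈ ({0, 1} : Finset ℕ),
                if (y.1 : ℕ) = (p * t + x.1) / 2 ∧ (y.2 : ℕ) = (q * t + x.2) / 2 then
                  (1 / 2 : ℝ) * (if ab.1 then (-1 : ℝ) ^ ((p * t + x.1) % 2) else 1) *
                    (if ab.2 then (-1 : ℝ) ^ ((q * t + x.2) % 2) else 1)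
                else 0)))).prod) s y| < 1) →
      (∃ m : ℕ, ∃ K : ℝ, K < 1 ∧ ∀ word : List (Bool × Bool),
        m ≤ (word.filter (fun ab => ab ≠ (false, false))).length →
        ∀ s : Fin p × Fin q, (∃ c T : ℕ, T < 2 ^ c ∧ (s.1 : ℕ) = p * T / 2 ^ c ∧ (s.2 : ℕ) = q * T / 2 ^ c) →
        ∑ y : Fin p × Fin q,
          |((word.map (fun ab : Bool × Bool =>
            (Matrix.of fun (x y : Fin p × Fin q) =>
              ∑ t ∈ ({0, 1} : Finset ℕ),
                if (y.1 : ℕ) = (p * t + x.1) / 2 ∧ (y.2 : ℕ) = (q * t + x.2) / 2 then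
                  (1 / 2 : ℝ) * (if ab.1 then (-1 : ℝ) ^ ((p * t + x.1) % 2) else 1) *
                    (if ab.2 then (-1 : ℝ) ^ ((q * t + x.2) % 2) else 1)
                else 0))).prod) s y| ≤ K) := by
  intro p q hp hq _ _ _ hST hNE
  classical
  obtain ⟨π, hπpos, hπzero, hπsum, hπinv, hG⟩ := hST
  obtain ⟨m, hm⟩ := hNE π hπpos hπzero hπsum hπinv
  set M : Bool × Bool → Matrix (Fin p × Fin q) (Fin p × Fin q) ℝ := fun ab : Bool × Bool =>
    (Matrix.of fun (x y : Fin p × Fin q) =>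
      ∑ t ∈ ({0, 1} : Finset ℕ),
        if (y.1 : ℕ) = (p * t + x.1) / 2 ∧ (y.2 : ℕ) = (q * t + x.2) / 2 then
          (1 / 2 : ℝ) * (if ab.1 then (-1 : ℝ) ^ ((p * t + x.1) % 2) else 1) *
            (if ab.2 then (-1 : ℝ) ^ ((q * t + x.2) % 2) else 1)
        else 0) with hM
  set U : Matrix (Fin p × Fin q) (Fin p × Fin q) ℝ := Matrix.of fun (x y : Fin p × Fin q) =>
    ∑ t ∈ ({0, 1} : Finset ℕ),
      if (y.1 : ℕ) = (p * t + x.1) / 2 ∧ (y.2 : ℕ) = (q * t + x.2) / 2 then (1 / 2 : ℝ) else 0 with hU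
  have hMU : M (false, false) = U := by ext x y; simp [hM, hU]
  -- a bound `< 1` for each (state, twisted letters), by `core`; then the maximum over this finite set
  have key : ∀ sl : (Fin p × Fin q) × (Fin m → Bool × Bool), ∃ K : ℝ, K < 1 ∧
      ((∃ c T : ℕ, T < 2 ^ c ∧ (sl.1.1 : ℕ) = p * T / 2 ^ c ∧ (sl.1.2 : ℕ) = q * T / 2 ^ c) →
        (∀ i, sl.2 i ≠ (false, false)) → ∀ k : Fin m → ℕ,
          ∑ y, |((List.ofFn fun i => List.replicate (k i) (false, false) ++ [sl.2 i]).flatten.map M).prod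
            sl.1 y| ≤ K) := by
    rintro ⟨s, ℓ⟩
    by_cases h : (∃ c T : ℕ, T < 2 ^ c ∧ (s.1 : ℕ) = p * T / 2 ^ c ∧ (s.2 : ℕ) = q * T / 2 ^ c) ∧
        ∀ i, ℓ i ≠ (false, false)
    · obtain ⟨K, hK, hb⟩ := core _ M U π m hMU (reach_step M hM) hπzero hG hm s h.1 ℓ h.2
      exact ⟨K, hK, fun _ _ => hb⟩
    · exact ⟨0, one_pos, fun hs hℓ => (h ⟨hs, hℓ⟩).elim⟩
  choose Kf hKf hbd using key
  have hne : (Finset.univ : Finset ((Fin p × Fin q) × (Fin m → Bool × Bool))).Nonempty :=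
    ⟨((⟨0, hp.pos⟩, ⟨0, hq.pos⟩), fun _ => (false, false)), Finset.mem_univ _⟩
  refine ⟨m, Finset.univ.sup' hne Kf, (Finset.sup'_lt_iff hne).2 fun sl _ => hKf sl, fun word hw s hs => ?_⟩
  -- split off the tail after the `m`-th twisted letter; it only contracts
  obtain ⟨k, ℓ, rest, hℓ, rfl⟩ := exists_blocks (false, false) m word hw
  rw [List.map_append, List.prod_append]
  exact ((l1_mul_prod_le M (sum_abs_letter_le M hM) rest _).trans (hbd (s, ℓ) hs hℓ k)).trans
    (Finset.le_sup' Kf (Finset.mem_univ (s, ℓ)))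

end Summit.QuantumAdvantage.QuantumAdvantage.Theorems.MobiusLadderQuadraticDigitPhasesStubUwcOfNoExact
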